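import Literature.Probability.LatticeModels.SRWKilledWalkFunctionals
import Literature.Probability.LatticeModels.HoleFreePotential
import Literature.Probability.RandomPlanarGeometry.ChordalLERWScalingLimit
import Literature.Probability.RandomPlanarGeometry.ConformalMap
import HarnessLib

/-!
# Convergence of the Green's function of simple random walk in simply connected discrete domains under Carathéodory approximation (Chelkak–Smirnov 2011, Thm. 3.9; Chelkak–Wan 2021, Cor. 3.3)

Topic `Literature/Probability/LatticeModels` (discrete potential theory on `ℤ²`; companions
`SRWKilledWalkFunctionals.lean` — the killed Green function `SRW.killedGreen`,
`HoleFreePotential.lean` — `HoleFree` (= simply connected) lattice sets,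
`GreenFunctionConformalRadius.lean` — Kozdron–Lawler's Thm. 1.2 in the same vocabulary).

D. Chelkak, Y. Wan, *On the convergence of massive loop-erased random walks to massive SLE(2)
curves*, Electron. J. Probab. 26 (2021), paper 54 (arXiv:1903.08045), §2.1 and §3.1:

> §2.1: "we approximate `(Ω; a, b)` by simply connected subgraphs `Ω^δ` of the square grids `δℤ²` …
> to each simply connected graph `Ω^δ ⊂ δℤ²` we associate an open simply connected polygonal domain
> `Ω̂^δ ⊂ ℂ` by taking the union of all open `2δ × 2δ` squares centered at vertices of `Ω^δ` …
> `Int Ω^δ := V(Ω^δ)`, `∂Ω^δ := {(v; (v_int, v)) : v ∉ Int Ω^δ, v ∼ v_int, v_int ∈ Int Ω^δ}` …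
> `Z_{Ω^δ}(w^δ, z^δ) := Σ_{π^δ ∈ S_{Ω^δ}(w^δ; z^δ)} (1/4)^{#π^δ}`, where `S_{Ω^δ}(w^δ; z^δ)` denotes
> the set of all lattice paths connecting `w^δ` and `z^δ` inside `Ω^δ`, and `#π^δ` is the number of
> interior edges of `Ω^δ` in `π^δ`" (eq. (2.2) at `m = 0`).
> **Corollary 3.3.** "Let `Ω ⊂ B(0,R)` be a simply connected planar domain and `u, v ∈ Ω` be two
> distinct points of `Ω`. Assume that discrete domains `Ω̂^δ ⊂ B(0,R)` approximate `Ω` (in the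
> Carathéodory topology with respect to `u` or `v`) as `δ → 0`. Then
> `Z_{Ω^δ}(u^δ, v^δ) → G_Ω(u, v)` as `δ → 0`. Moreover, for each `r > 0` this convergence is
> uniform provided that `u` and `v` are jointly `r`-inside `Ω` and `|u − v| ≥ r`."

The proof ("this follows from (a more general in several aspects) uniform convergence result
provided by [CS11] and the convergence of the discrete full-plane Green function", Prop. 3.2) is
D. Chelkak, S. Smirnov, *Discrete complex analysis on isoradial graphs*, Adv. Math. 228 (2011)
1590–1630 (arXiv:0810.2188), Theorem 3.9 (uniform `C¹`-closeness of `G*_{Ω^δ_Γ}(·; v^δ)` to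
`G*_{Ω^δ}(·; v^δ)` inside `Ω^δ`, for all bounded simply connected discrete domains of an isoradial
graph `Γ`) together with Theorem 2.5 (Kenyon: `G_Γ(u; v) → (1/2π) log|u − v|`), where
(ibid. §2.1) a discrete domain is a set `F ∪ E ∪ V` of open faces, open edges and vertices of `Γ`
whose union is an OPEN simply connected set with connected skeleton, `Int Ω^δ_Γ := V` — so every
edge of `Γ` at an interior vertex is an edge of the domain: the random walk is the simple random
walk on `Γ` KILLED AT ITS FIRST VERTEX OUTSIDE `V` (induced subgraphs; Chelkak–Wan's `∂Ω^δ` says the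
same) — and (ibid. §3.2) `Ω_n → Ω` in the sense of kernel (Carathéodory) convergence iff
"(i) some neighborhood of every `u ∈ Ω` lies in `Ω_n` for large enough `n`; (ii) for every
`a ∈ ∂Ω` there exist `a_n ∈ ∂Ω_n` such that `a_n → a`".

This file only STATES Corollary 3.3 (pointwise part) as a named fact (`def … : Prop`), in the tree's
vocabulary and in lattice units (the domains are rescaled by `δ`, the walk is not):
`Z_{Ω^δ}(u^δ, v^δ) = SRW.killedGreen (ChordalLERW.siteGraph A_δ) u^δ v^δ` — the expected number of
visits to `v^δ` (time `0` included) of simple random walk from `u^δ` before its first step out of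
the vertex set `A_δ ⊂ ℤ²` (for `siteGraph A` "the first `n` steps are edges" says `S₀, …, S_n ∈ A`);
simple connectivity of the discrete domain is the tree's combinatorial `HoleFree` (every site outside
`A` escapes to infinity through sites outside `A`) plus connectedness, as in
`GreenFunctionConformalRadius.lean` — for the union `Ω̂` of the open stars (`ChelkakSmirnov.starDomain`)
this is exactly "`Ω̂` simply connected with connected skeleton": `ℂ ∖ Ω̂` is the union of the closed
cells none of whose vertices lies in `A`, so each of its components contains a lattice point, which
escapes; the polygonal representation is `δ • starDomain A_δ`; Carathéodory convergence is (i) + (ii)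
above along `δ → 0⁺` (`ChelkakSmirnov.KernelConvergence`); simple connectivity of `Ω` is witnessed
by a conformal equivalence `φ : ℍ → Ω` (a predicate-free `ConformalEquiv`, no choice made), through
which the limit is written: `G_Ω(u, v) = G_ℍ(φ⁻¹u, φ⁻¹v)`, `G_ℍ(x, y) = log(|x − ȳ|/|x − y|)`
(conformal invariance; independent of the choice of `φ` by Möbius invariance of `G_ℍ`).

NORMALISATION (read before using). For `Z` = the expected number of visits (eq. (2.2)) the limit is
`(2/π)·(log(1/|u − v|) + harmonic) = (2/π)·G_ℍ(φ⁻¹u, φ⁻¹v)`: the planar potential kernel is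
`a(x) = (2/π) log|x| + k₀ + O(|x|⁻²)` and `G_A(x, y) = E^x[a(S_τ − y)] − a(x − y)` (Lawler–Limic
2010, Thm. 4.4.4 and Prop. 4.6.2; Kozdron–Lawler 2005 §2.3, cf. `KozdronLawler.greenConst`);
equivalently, in [CS11] Def. 2.6 the Green's function is normalised by `μ(u₀)·Δ^δ G(u₀) = 1`,
i.e. `Σ_{u ∼ u₀} (G(u) − G(u₀)) = 1` on `ℤ²`, while the expected number of visits `N` has
`Σ_{u ∼ u₀} (N(u) − N(u₀)) = −4`, so `N = −4·G^{[CS11]} → −4·(1/2π) log|u − v| + … = (2/π) log(1/|u − v|) + …`.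
Chelkak–Wan write the limit as "`G_Ω`, the positive Green function", displayed in their (2.3), (4.2)
with the factor `1/2π` of the kernel of `(−Δ_Ω)⁻¹`; with `Z` as in (2.2) that display is off by this
factor `4` (immaterial in [CW21], where only ratios and Harnack-type bounds of `Z` are used). The
statement below is the one PROVED by [CS11, Thm. 3.9 + Thm. 2.5] for the quantity (2.2), with the
constant made explicit; a numerical check (disc of radius `16`: `N(0, 8) = 0.4527` against
`(2/π) log 2 = 0.4413`, `(1/2π) log 2 = 0.1103`) is recorded in the worker notes of
stmt-CriticalPhenomena-10649 (line `symplectic-fermion-anchor`, stub INT).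

Deliberately NOT here: the proof; the uniform clause of Cor. 3.3 and the uniform Prop. 3.2
(`|Z_{Ω^δ} − G_{Ω̂^δ}| ≤ ε(δ, r, R)` for all simply connected discrete domains in `B(0,R)` and all
pairs jointly `r`-inside — TODO(general form), it needs "jointly `r`-inside"); the massive case
(Prop. 3.12); the Poisson-kernel ratios (Prop. 3.5, Cor. 3.6); and any statement for NON-induced
subgraphs of `ℤ²` (walks killed on edges, e.g. the tree's `discreteDomainGraph`, whose edges are the
lattice edges with closed segment inside the closure of the domain): [CS11]/[CW21] do not cover them
(Chelkak 2016, Ann. Probab. 44, §2.2 only remarks that the induced assumption "can be easily removed").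

## References

* D. Chelkak, Y. Wan, Electron. J. Probab. 26 (2021), paper no. 54, §2.1, §3.1 (Def. 3.1,
  Prop. 3.2, Cor. 3.3) [ChelkakWan2021].
* D. Chelkak, S. Smirnov, Adv. Math. 228 (2011) 1590–1630, §2.1, Def. 2.6, §3.2, Thm. 3.9
  [ChelkakSmirnov2011].
* G. F. Lawler, V. Limic, *Random Walk: A Modern Introduction*, CUP (2010), Thm. 4.4.4, Prop. 4.6.2
  [LawlerLimic2010].
-/

noncomputable section

open Set Metric Filter
open scoped Topology Pointwise
open Literature.Probability.RandomPlanarGeometry (ChordalLERW.siteGraph ConformalEquiv)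

namespace Literature.Probability.LatticeModels

namespace ChelkakSmirnov

/-- The **polygonal representation** (continuous counterpart) of a lattice vertex set `A ⊂ ℤ²`, in
lattice units: the union of the OPEN squares of side `2` centred at the sites of `A` — the open
stars of the vertices, i.e. the open faces, open edges and vertices of `ℤ²` incident to `A`
([CS11] §2.1: `Ω^δ = F ∪ E ∪ V`; [CW21] §2.1: "the union of all open `2δ × 2δ` squares centered at
vertices of `Ω^δ`", here with `δ = 1`; the mesh-`δ` domain is `δ • starDomain A`).
[cite: ChelkakWan2021, §2.1] -/
def starDomain (A : Set (Site 2)) : Set ℂ :=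
  ⋃ x ∈ A, {z : ℂ | |z.re - ((x 0 : ℤ) : ℝ)| < 1 ∧ |z.im - ((x 1 : ℤ) : ℝ)| < 1}

/-- A **(bounded) simply connected discrete domain** of `ℤ²` ([CS11] §2.1, [CW21] §2.1), given by
its finite vertex set `A = Int Ω^δ`: nonempty, connected through nearest-neighbour steps inside `A`
(connected skeleton), and `HoleFree` — every site outside `A` escapes to infinity through sites
outside `A`, which for the union of open stars `starDomain A` is exactly simple connectivity (the
complement of `starDomain A` is the union of the closed cells with no vertex in `A`, so each of its
components contains a lattice point). The walk of the domain is the simple random walk killed at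
its first vertex outside `A` (`ChordalLERW.siteGraph A`: all lattice edges between sites of `A`).
[cite: ChelkakSmirnov2011, §2.1] -/
def IsDiscreteDomain (A : Finset (Site 2)) : Prop :=
  A.Nonempty ∧ ((zdGraph 2).induce (↑A : Set (Site 2))).Connected ∧ HoleFree (↑A : Set (Site 2))

/-- **Kernel (Carathéodory) convergence** of a family of planar open sets `U δ` to the domain `Ω`
as `δ → 0⁺`, in the form of [CS11] §3.2: "(i) some neighborhood of every `u ∈ Ω` lies in `Ω_n` for
large enough `n`; (ii) for every `a ∈ ∂Ω` there exist `a_n ∈ ∂Ω_n` such that `a_n → a`"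
(for uniformly bounded simply connected domains containing the reference point this is Carathéodory's
kernel convergence with respect to any point of `Ω`, Pommerenke 1992 Thm. 1.8). [cite: ChelkakSmirnov2011, §3.2] -/
def KernelConvergence (U : ℝ → Set ℂ) (Ω : Set ℂ) : Prop :=
  (∀ z ∈ Ω, ∃ ρ : ℝ, 0 < ρ ∧ ∀ᶠ δ in 𝓝[>] (0 : ℝ), ball z ρ ⊆ U δ) ∧
    ∀ a ∈ frontier Ω, ∀ ρ : ℝ, 0 < ρ → ∀ᶠ δ in 𝓝[>] (0 : ℝ), (frontier (U δ) ∩ ball a ρ).Nonempty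

end ChelkakSmirnov

/-- **Chelkak–Wan 2021, Corollary 3.3 (pointwise part) = Chelkak–Smirnov 2011, Theorem 3.9 with
Theorem 2.5, on `ℤ²`** (named fact, unproved here). Let `Ω ⊆ B(0, R)` be a simply connected planar
domain (open; simple connectivity witnessed by a conformal equivalence `φ : ℍ → Ω`) and let
`A_δ ⊂ ℤ²`, `δ → 0⁺`, be simply connected discrete domains (`ChelkakSmirnov.IsDiscreteDomain`) whose
polygonal representations `Ω̂^δ = δ • starDomain A_δ ⊆ B(0, R)` converge to `Ω` in the kernel
(Carathéodory) sense. Then for distinct `u, v ∈ Ω` and interior vertices `u^δ, v^δ ∈ A_δ` with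
`δu^δ → u`, `δv^δ → v`, the Green's function of simple random walk killed at its first exit from
`A_δ` — `Z_{Ω^δ}(u^δ, v^δ) = Σ_{paths u^δ → v^δ inside} 4^{-#π}`, the expected number of visits,
`SRW.killedGreen (ChordalLERW.siteGraph A_δ) u^δ v^δ` — converges as `δ → 0⁺` to the Green's function
of `Ω`, `(2/π)·G_ℍ(φ⁻¹u, φ⁻¹v)` with `G_ℍ(x, y) = log(|x − ȳ|/|x − y|)` (normalisation of the
expected number of visits; see the module docstring for the factor `4` against the `(−Δ)⁻¹`-kernel
display of [CW21]). "`Z_{Ω^δ}(u^δ, v^δ) → G_Ω(u, v)` as `δ → 0`."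
[cite: ChelkakWan2021, Corollary 3.3 (§3.1); proof: ChelkakSmirnov2011 Thm. 3.9 + Thm. 2.5] -/
-- TODO(general form): the uniform clause ("for each r > 0 uniform for u, v jointly r-inside Ω,
-- |u − v| ≥ r") and the domain-uniform Prop. 3.2 need the notion "jointly r-inside"; [CS11] Thm. 3.9
-- is stated for all isoradial graphs, here only `ℤ²`.
def killedGreen_tendsto_of_kernelConvergence : Prop :=
  ∀ (Ω : Set ℂ) (R : ℝ), IsOpen Ω → Ω ⊆ ball (0 : ℂ) R →
    ∀ (φ : ConformalEquiv UpperHalfPlane.upperHalfPlaneSet Ω) (A : ℝ → Finset (Site 2)),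
      (∀ᶠ δ in 𝓝[>] (0 : ℝ), ChelkakSmirnov.IsDiscreteDomain (A δ) ∧
        δ • ChelkakSmirnov.starDomain (↑(A δ) : Set (Site 2)) ⊆ ball (0 : ℂ) R) →
      ChelkakSmirnov.KernelConvergence
        (fun δ => δ • ChelkakSmirnov.starDomain (↑(A δ) : Set (Site 2))) Ω →
    ∀ (u v : ℂ), u ∈ Ω → v ∈ Ω → u ≠ v →
    ∀ (uδ vδ : ℝ → Site 2), (∀ᶠ δ in 𝓝[>] (0 : ℝ), uδ δ ∈ A δ ∧ vδ δ ∈ A δ) →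
      Tendsto (fun δ : ℝ => (δ : ℂ) * Site.toComplex (uδ δ)) (𝓝[>] 0) (𝓝 u) →
      Tendsto (fun δ : ℝ => (δ : ℂ) * Site.toComplex (vδ δ)) (𝓝[>] 0) (𝓝 v) →
      Tendsto (fun δ : ℝ => SRW.killedGreen (ChordalLERW.siteGraph (↑(A δ) : Set (Site 2))) (uδ δ) (vδ δ))
        (𝓝[>] 0) (𝓝 (2 / Real.pi *
          Real.log (‖φ.symm u - (starRingEnd ℂ) (φ.symm v)‖ / ‖φ.symm u - φ.symm v‖)))

end Literature.Probability.LatticeModels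

end
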